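import Mathlib
import Summits.Schanuel.Schanuel.Theorems.RootDecomp1EEngineType

-- `Summit.Schanuel.Schanuel.…` is the mandated layout of this single-problem summit (CONVENTIONS §1).
set_option linter.dupNamespace false

/-!
# RootDecomp1E — lens 2, gen 10 «EngineType» (part 2/2): the certified cells `(iπ, 1, i)` and `(π, 1, iπ)`

THEOREM ROUND on `route-Schanuel-RootDecomp1E`, supporting the residual `RootDecomp1E.PlainDefectOne`
(stmt-Schanuel-31410) at its first open length `n = 3`.  Two certified members of 31410's hypothesis class — ℚ-free,
PLAIN (indeed with NO irrational multiplier at all; only `π ∉ ℚ` is used), sub-minimal — on which 31410's conclusion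
`3 ≤ trdeg F_z + 1` is PROVED, one per new engine clause of part 1:
* EULER'S TRIPLE `z₁ = (iπ, 1, i)`: `trdeg ℚ(πi, i, −1, e, eⁱ) ≥ 2` HYPOTHESIS-FREE (Lindemann–Weierstrass at `(1, i)`,
  tree theorem `algebraicIndependent_exp_holds`) — `defectOne_at_eulerTriple`;
* THE NESTERENKO TRIPLE `z₂ = (π, 1, iπ)`: `trdeg ℚ(π, e^π, e, −1) ≥ 2` mod the tree fact `nesterenko` (PROVED in the
  tree, `nesterenko_holds`; hypothesis form only because its cone has no farm olean) — `defectOne_at_nesterenkoTriple`.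
`S` itself is OPEN at both (each instance implies `e ⊥ π`, the tree's open `ExpOnePiAlgebraicIndependent`).  Behind
them the decided FAMILIES `lwRich_of_algebraic_pair_mem_span` (two ℚ-free algebraic numbers in the span) and
`periodRich_of_pi_mem_span` (the whole `π`-sector).
Sorry-free; axioms `propext`, `Classical.choice`, `Quot.sound`.
[cite: BakerTNT1975, Ch. 1 Thm 1.4] [cite: NesterenkoPhilippon2001, Ch. 3 Cor. 1.2] [cite: Nesterenko1996SbMath]
-/

noncomputable section

namespace Summit.Schanuel.Schanuel.Theorems.RootDecomp1EEngineType

open Complex IntermediateField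
open Summit.Schanuel.Schanuel.Theorems.RootDecomp1EAnchor (isAlgebraic_of_mem_adjoin mem_adjoin_of_mem_span
  exp_isAlgebraic_of_mem_span)
open Summit.Schanuel.Schanuel.Theorems.RootDecomp1EEStableRung (defectOne_of_le_two)
open Summit.Schanuel.Schanuel.Theorems.RootDecomp1EModuleGrids (subMinimal_three rat_mul_pi_eq_rat)
open Summit.Schanuel.Schanuel.Theorems.RootDecomp1EModuleType (SubMinimalDefect)
open Literature.Barriers.Schanuel (isAlgebraic_I)
open Literature.NumberTheory.Transcendental (nesterenko)

/-! ## §6 Certified literal members of stmt-31410's first open layer `n = 3`, newly decided — one per new clause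

Both tuples below are certified members of the hypothesis class of stmt-Schanuel-31410 at its first open length
`n = 3` — ℚ-free, PLAIN (indeed: NO irrational multiplier at all; only `π ∉ ℚ` is used), sub-minimal
(`subMinimal_three`) — on which 31410's conclusion `3 ≤ trdeg F_z + 1` is PROVED here; neither is certifiably
module-rich or module-poor (round 9's classes), and `S` itself is open at both (each instance of `S` implies
`e ⊥ π`, the tree's OPEN `ExpOnePiAlgebraicIndependent`). -/

/-- The two families behind the literal members.  (L): two ℚ-free ALGEBRAIC numbers in the span make `z` LW-rich
(all `(1, β, w…)` with `β ∈ ℚ̄ ∖ ℚ`). -/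
theorem lwRich_of_algebraic_pair_mem_span {ι : Type*} (z : ι → ℂ) (b : Fin 2 → ℂ) (hb : LinearIndependent ℚ b)
    (halg : ∀ k, IsAlgebraic ℚ (b k)) (hmem : ∀ k, b k ∈ Submodule.span ℚ (Set.range z)) : LWRich z :=
  ⟨b, hb, halg, fun k => exp_isAlgebraic_of_mem_span (hmem k)⟩

/-- (N): the whole `π`-SECTOR — `π ∈ span_ℚ z` makes `z` Nesterenko-rich (all `(π, w₁, w₂, …)`). -/
theorem periodRich_of_pi_mem_span {ι : Type*} (z : ι → ℂ) (hπ : (Real.pi : ℂ) ∈ Submodule.span ℚ (Set.range z)) :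
    PeriodRich z :=
  ⟨isAlgebraic_of_mem_adjoin (mem_adjoin_of_mem_span hπ), Or.inl (exp_isAlgebraic_of_mem_span hπ)⟩

/-- `(1, i)` is ℚ-free. -/
theorem linearIndependent_one_I : LinearIndependent ℚ ![(1 : ℂ), I] := by
  rw [LinearIndependent.pair_iff]
  intro s t hst
  rw [Rat.smul_def, Rat.smul_def] at hst
  have hre := congrArg Complex.re hst
  have him := congrArg Complex.im hst
  simp only [Complex.add_re, Complex.add_im, Complex.mul_re, Complex.mul_im, Complex.I_re, Complex.I_im,
    Complex.ratCast_re, Complex.ratCast_im, Complex.zero_re, Complex.zero_im,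
    mul_zero, add_zero, zero_add, mul_one, sub_self] at hre him
  exact ⟨by exact_mod_cast hre, by exact_mod_cast him⟩

/-- **EULER'S TRIPLE `z₁ = (iπ, 1, i)`** (`e^{iπ} = −1`, `e`, `e^i`). -/
def eulerTriple : Fin 3 → ℂ := ![(Real.pi : ℂ) * I, 1, I]

/-- `z₁` is ℚ-free (`π ∉ ℚ`). -/
theorem eulerTriple_linearIndependent : LinearIndependent ℚ eulerTriple := by
  rw [Fintype.linearIndependent_iff]
  intro g hg
  simp only [Fin.sum_univ_three, eulerTriple, Matrix.cons_val_zero, Matrix.cons_val_one, Matrix.cons_val_two,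
    Matrix.tail_cons, Matrix.head_cons, Rat.smul_def] at hg
  have hre := congrArg Complex.re hg
  have him := congrArg Complex.im hg
  simp only [Complex.add_re, Complex.add_im, Complex.mul_re, Complex.mul_im, Complex.ofReal_re,
    Complex.ofReal_im, Complex.I_re, Complex.I_im, Complex.ratCast_re, Complex.ratCast_im,
    Complex.zero_re, Complex.zero_im, mul_zero, zero_mul, add_zero, zero_add,
    mul_one, sub_self] at hre him
  have hπ : (g 0 : ℝ) * Real.pi = ((-g 2 : ℚ) : ℝ) := by push_cast; linear_combination him
  obtain ⟨h0, h2⟩ := rat_mul_pi_eq_rat hπ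
  intro i
  fin_cases i
  · exact h0
  · exact_mod_cast hre
  · simpa using h2

/-- `z₁` has NO irrational multiplier (so it is PLAIN, the hypothesis of stmt-31410): `β·z₁ ⊆ span_ℚ z₁ ⟹ β ∈ ℚ`. -/
theorem eulerTriple_multiplier_rational (β : ℂ)
    (hβ : ∀ i, β * eulerTriple i ∈ Submodule.span ℚ (Set.range eulerTriple)) : β ∈ Set.range (algebraMap ℚ ℂ) := by
  obtain ⟨a, ha⟩ := (Submodule.mem_span_range_iff_exists_fun ℚ).mp (hβ 1)
  obtain ⟨b, hb⟩ := (Submodule.mem_span_range_iff_exists_fun ℚ).mp (hβ 2)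
  obtain ⟨c, hc⟩ := (Submodule.mem_span_range_iff_exists_fun ℚ).mp (hβ 0)
  simp only [Fin.sum_univ_three, eulerTriple, Matrix.cons_val_zero, Matrix.cons_val_one,
    Matrix.cons_val_two, Matrix.tail_cons, Matrix.head_cons, Rat.smul_def] at ha hb hc
  have ha_re := congrArg Complex.re ha
  have ha_im := congrArg Complex.im ha
  have hb_re := congrArg Complex.re hb
  have hc_re := congrArg Complex.re hc
  simp only [Complex.add_re, Complex.add_im, Complex.mul_re, Complex.mul_im, Complex.ofReal_re,
    Complex.ofReal_im, Complex.I_re, Complex.I_im, Complex.ratCast_re, Complex.ratCast_im,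
    mul_zero, zero_mul, add_zero, zero_add, mul_one, sub_self] at ha_re ha_im hb_re hc_re
  -- ha_re : a 1 = β.re ; ha_im : a 0 π + a 2 = β.im ; hb_re : b 1 = -β.im ; hc_re : c 1 = -β.im π
  have hπ1 : (a 0 : ℝ) * Real.pi = ((-b 1 - a 2 : ℚ) : ℝ) := by push_cast; linear_combination ha_im + hb_re
  obtain ⟨ha0, _⟩ := rat_mul_pi_eq_rat hπ1
  have hyim : β.im = (a 2 : ℝ) := by
    have := ha_im
    rw [ha0] at this
    push_cast at this
    linear_combination -this
  have hπ2 : (a 2 : ℝ) * Real.pi = ((-c 1 : ℚ) : ℝ) := by push_cast; rw [← hyim]; linear_combination hc_re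
  obtain ⟨ha2, _⟩ := rat_mul_pi_eq_rat hπ2
  refine ⟨a 1, ?_⟩
  apply Complex.ext
  · simpa using ha_re
  · simp [hyim, ha2]

/-- `z₁` is a member of 31410's hypothesis class: ℚ-free, plain, sub-minimal. -/
theorem eulerTriple_mem_plainClass :
    LinearIndependent ℚ eulerTriple ∧
      (∀ β : ℂ, IsAlgebraic ℚ β → (∀ i, β * eulerTriple i ∈ Submodule.span ℚ (Set.range eulerTriple)) →
        β ∈ Set.range (algebraMap ℚ ℂ)) ∧ SubMinimalDefect 3 eulerTriple :=
  ⟨eulerTriple_linearIndependent, fun β _ hβ => eulerTriple_multiplier_rational β hβ, subMinimal_three _⟩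

/-- `z₁` is LW-rich with `b = (1, i)`. -/
theorem eulerTriple_lwRich : LWRich eulerTriple := by
  refine lwRich_of_algebraic_pair_mem_span eulerTriple ![(1 : ℂ), I] linearIndependent_one_I ?_ ?_
  · intro k; fin_cases k
    · simpa using isAlgebraic_one
    · simpa using isAlgebraic_I
  · intro k; fin_cases k
    · exact Submodule.subset_span ⟨1, by simp [eulerTriple]⟩
    · exact Submodule.subset_span ⟨2, by simp [eulerTriple]⟩

/-- **`trdeg ℚ(iπ, i, −1, e, eⁱ) ≥ 2`, HYPOTHESIS-FREE** (Lindemann–Weierstrass at `(1, i)`). -/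
theorem two_le_trdeg_eulerTriple :
    (2 : Cardinal) ≤ Algebra.trdeg ℚ ↥(adjoin ℚ (Set.range eulerTriple ∪ Set.range (cexp ∘ eulerTriple))) :=
  two_le_trdeg_of_lwRich _ eulerTriple_lwRich

/-- **The conclusion of stmt-31410 at its member `z₁`, PROVED outright.** -/
theorem defectOne_at_eulerTriple :
    ((3 : ℕ) : Cardinal) ≤ Algebra.trdeg ℚ ↥(adjoin ℚ (Set.range eulerTriple ∪ Set.range (cexp ∘ eulerTriple))) + 1 := by
  exact_mod_cast defectOne_three_of_lwRich _ eulerTriple_lwRich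

/-- … in the exact shape of the residual items: every engine-dark-type item is silent at `z₁`, the rich item decides it. -/
theorem engineRich_eulerTriple : EngineRich eulerTriple := Or.inr (Or.inl eulerTriple_lwRich)

/-- **THE NESTERENKO TRIPLE `z₂ = (π, 1, iπ)`** (`e^π`, `e`, `e^{iπ} = −1`). -/
def nesterenkoTriple : Fin 3 → ℂ := ![(Real.pi : ℂ), 1, (Real.pi : ℂ) * I]

/-- `z₂` is ℚ-free (`π ∉ ℚ`). -/
theorem nesterenkoTriple_linearIndependent : LinearIndependent ℚ nesterenkoTriple := by
  rw [Fintype.linearIndependent_iff]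
  intro g hg
  simp only [Fin.sum_univ_three, nesterenkoTriple, Matrix.cons_val_zero, Matrix.cons_val_one,
    Matrix.cons_val_two, Matrix.tail_cons, Matrix.head_cons, Rat.smul_def] at hg
  have hre := congrArg Complex.re hg
  have him := congrArg Complex.im hg
  simp only [Complex.add_re, Complex.add_im, Complex.mul_re, Complex.mul_im, Complex.ofReal_re,
    Complex.ofReal_im, Complex.I_re, Complex.I_im, Complex.ratCast_re, Complex.ratCast_im,
    Complex.zero_re, Complex.zero_im, mul_zero, zero_mul, sub_zero, add_zero, zero_add,
    mul_one, sub_self] at hre him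
  -- hre : g 0 π + g 1 = 0 ; him : g 2 π = 0
  have hπ1 : (g 0 : ℝ) * Real.pi = ((-g 1 : ℚ) : ℝ) := by push_cast; linear_combination hre
  obtain ⟨h0, h1⟩ := rat_mul_pi_eq_rat hπ1
  have hπ2 : (g 2 : ℝ) * Real.pi = ((0 : ℚ) : ℝ) := by rw [Rat.cast_zero]; linear_combination him
  obtain ⟨h2, _⟩ := rat_mul_pi_eq_rat hπ2
  intro i
  fin_cases i
  · exact h0
  · simpa using h1
  · exact h2

/-- `z₂` has NO irrational multiplier (so it is PLAIN): only `π ∉ ℚ` is used. -/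
theorem nesterenkoTriple_multiplier_rational (β : ℂ)
    (hβ : ∀ i, β * nesterenkoTriple i ∈ Submodule.span ℚ (Set.range nesterenkoTriple)) :
    β ∈ Set.range (algebraMap ℚ ℂ) := by
  obtain ⟨a, ha⟩ := (Submodule.mem_span_range_iff_exists_fun ℚ).mp (hβ 1)
  obtain ⟨b, hb⟩ := (Submodule.mem_span_range_iff_exists_fun ℚ).mp (hβ 0)
  obtain ⟨c, hc⟩ := (Submodule.mem_span_range_iff_exists_fun ℚ).mp (hβ 2)
  simp only [Fin.sum_univ_three, nesterenkoTriple, Matrix.cons_val_zero, Matrix.cons_val_one,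
    Matrix.cons_val_two, Matrix.tail_cons, Matrix.head_cons, Rat.smul_def] at ha hb hc
  have ha_re := congrArg Complex.re ha
  have ha_im := congrArg Complex.im ha
  have hb_im := congrArg Complex.im hb
  have hc_im := congrArg Complex.im hc
  simp only [Complex.add_re, Complex.add_im, Complex.mul_re, Complex.mul_im, Complex.ofReal_re,
    Complex.ofReal_im, Complex.I_re, Complex.I_im, Complex.ratCast_re, Complex.ratCast_im,
    mul_zero, zero_mul, sub_zero, add_zero, zero_add, mul_one, sub_self] at ha_re ha_im hb_im hc_im
  -- ha_re : a 0 π + a 1 = β.re ; ha_im : a 2 π = β.im ; hb_im : b 2 π = β.im π ; hc_im : c 2 π = β.re π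
  have hπ : Real.pi ≠ 0 := Real.pi_ne_zero
  have hyim : β.im = (b 2 : ℝ) := by
    have h : (β.im - (b 2 : ℝ)) * Real.pi = 0 := by linear_combination -hb_im
    have := (mul_eq_zero.mp h).resolve_right hπ
    linear_combination this
  have hπ2 : (a 2 : ℝ) * Real.pi = ((b 2 : ℚ) : ℝ) := by linear_combination ha_im + hyim
  obtain ⟨_, hb2⟩ := rat_mul_pi_eq_rat hπ2
  have hxre : β.re = (c 2 : ℝ) := by
    have h : (β.re - (c 2 : ℝ)) * Real.pi = 0 := by linear_combination -hc_im
    have := (mul_eq_zero.mp h).resolve_right hπ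
    linear_combination this
  have hπ0 : (a 0 : ℝ) * Real.pi = ((c 2 - a 1 : ℚ) : ℝ) := by push_cast; linear_combination ha_re + hxre
  obtain ⟨_, _⟩ := rat_mul_pi_eq_rat hπ0
  refine ⟨c 2, ?_⟩
  apply Complex.ext
  · simp [hxre]
  · simp [hyim, hb2]

/-- `z₂` is a member of 31410's hypothesis class: ℚ-free, plain, sub-minimal. -/
theorem nesterenkoTriple_mem_plainClass :
    LinearIndependent ℚ nesterenkoTriple ∧
      (∀ β : ℂ, IsAlgebraic ℚ β → (∀ i, β * nesterenkoTriple i ∈ Submodule.span ℚ (Set.range nesterenkoTriple)) →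
        β ∈ Set.range (algebraMap ℚ ℂ)) ∧ SubMinimalDefect 3 nesterenkoTriple :=
  ⟨nesterenkoTriple_linearIndependent, fun β _ hβ => nesterenkoTriple_multiplier_rational β hβ, subMinimal_three _⟩

/-- `z₂` is Nesterenko-rich (it lies in the `π`-sector). -/
theorem nesterenkoTriple_periodRich : PeriodRich nesterenkoTriple :=
  periodRich_of_pi_mem_span _ (Submodule.subset_span ⟨0, by simp [nesterenkoTriple]⟩)

/-- **`trdeg ℚ(π, e^π, e, −1) ≥ 2`, mod `nesterenko` only** (Nesterenko's `π ⊥ e^π`). -/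
theorem two_le_trdeg_nesterenkoTriple (hN : nesterenko) :
    (2 : Cardinal) ≤ Algebra.trdeg ℚ ↥(adjoin ℚ (Set.range nesterenkoTriple ∪ Set.range (cexp ∘ nesterenkoTriple))) := by
  have hπ : (Real.pi : ℂ) ∈ Submodule.span ℚ (Set.range nesterenkoTriple) :=
    Submodule.subset_span ⟨0, by simp [nesterenkoTriple]⟩
  refine two_le_trdeg_of_algebraicIndependent_of_isAlgebraic _ (algebraicIndependent_pi_exp_pi hN) ?_
  intro i; fin_cases i
  · exact isAlgebraic_of_mem_adjoin (mem_adjoin_of_mem_span hπ)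
  · exact exp_isAlgebraic_of_mem_span hπ

/-- **The conclusion of stmt-31410 at its member `z₂`, PROVED mod `nesterenko`.** -/
theorem defectOne_at_nesterenkoTriple (hN : nesterenko) :
    ((3 : ℕ) : Cardinal) ≤
      Algebra.trdeg ℚ ↥(adjoin ℚ (Set.range nesterenkoTriple ∪ Set.range (cexp ∘ nesterenkoTriple))) + 1 := by
  have h3 : (2 : Cardinal) + 1 ≤
      Algebra.trdeg ℚ ↥(adjoin ℚ (Set.range nesterenkoTriple ∪ Set.range (cexp ∘ nesterenkoTriple))) + 1 :=
    add_le_add (two_le_trdeg_nesterenkoTriple hN) le_rfl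
  have h21 : (2 : Cardinal) + 1 = 3 := by norm_num
  rw [h21] at h3
  exact_mod_cast h3

/-- `EngineRich nesterenkoTriple`. -/
theorem engineRich_nesterenkoTriple : EngineRich nesterenkoTriple := Or.inr (Or.inr nesterenkoTriple_periodRich)

/-- VACUITY GUARD for the residual's hypothesis class is inherited from round 9 (`not_moduleRich_one`: `(1)` is
module-poor) only up to the new clauses; at `n ≤ 2` darkness is irrelevant (layers decided).  Engine-darkness of a
literal TRIPLE is transcendence-open (B1/B3) — the declared caveat of this residual, as of rounds 7–9's. -/
theorem engineDarkDefectOneAt_le_two {n : ℕ} (hn : n ≤ 2) : EngineDarkDefectOneAt n :=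
  fun z hz _ _ => defectOne_of_le_two n hn z hz

end Summit.Schanuel.Schanuel.Theorems.RootDecomp1EEngineType

end
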